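import Mathlib
import HarnessLib
import HarnessLib.Audit
import Summits.FinalStateConjecture.Statement
import HarnessLib.Audit.Status.Attr

/-!
Route: AtomicSupermomentum

# Route AtomicSupermomentum — count the final black holes at scri (atomic late-time mass aspect),
then rebuild the radiation zone inward and capture the near zones

It suffices to show X = X1 ∧ X2 (card supermomentum-atomicity-at-scri, its assembly sketch split at
the radiation-zone / near-zone
seam). X1 (GenericRadiationZone, the 𝓘⁺ side, ALL genericity spent here): for Christodoulou-generic
admissible data the MGHD exists and
every MGHD has complete 𝓘⁺, admits a RADIATION-ZONE STRUCTURE — finitely many straight timelike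
world-lines t ↦ Λᵢ(t,0)+cᵢ, sublinear
excision radii ρᵢ = o(t), and a flat late chart Ψ₀ on the late half-space {x⁰ > τ₀} minus the tubes,
into J⁺(ιΣ), with Ψ₀^*g → η in C²
on the slabs {x⁰ = τ} — and admits NO late chart converging (C⁰, on every truncated near-zone slab)
to an extremal-or-overspinning
boosted Kerr (M ≤ |a|). The card's mechanism is the intended proof of X1: the late-time Bondi mass
aspect m_∞ = lim_{u→∞} m(u,·) exists
(finite radiated energy + finite memory), is supertranslation invariant, and is ATOMIC, m_∞ =
Σ_{i<N} Mᵢ K_{vᵢ} with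
K_v(n) = γ_v⁻³(1 − v·n)⁻³; the atoms (N, Mᵢ, vᵢ) are read off uniquely (KernelIndependence,
KernelMomentum) and the radiation zone is
rebuilt inward from 𝓘⁺ around the N boosted monopole far fields (informal cruxes
SupermomentumAtomicity, ScriToBulkRadiationZone, filed
after open; they need the definition BondiSachsRadiativeEnd). X2 (NearZoneCapture, pointwise): an
MGHD of an admissible datum with
complete 𝓘⁺, a radiation-zone structure and no degenerate Kerr limit settles down in the sense of
the Statement (sub-extremal
N-hole FinalStateDecomposition on O = J⁺(ιΣ) ∩ I⁻(charted) with exhaustive charts).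
Lean: `GenericRadiationZone ∧ NearZoneCapture`

## Assembly
Pure logic, sorry-free in Sketch.lean / glue.lean (`closes`, axioms propext · Classical.choice ·
Quot.sound): fix X; apply ChristodoulouGenericMono
with 𝓓 = admissibleVacuumData X, m = 1, P = the property of GenericRadiationZone and Q = the
property of the Statement; the pointwise implication
P D → Q D keeps the MGHD-existence conjunct and, for each maximal 𝒟, keeps complete 𝓘⁺ and feeds
(complete 𝓘⁺, radiation zone, no degenerate
Kerr limit) to NearZoneCapture. The conclusion is `FinalStateConjecture` by name.

Rationale: WHY THIS LINE. The final state conjecture mixes three things: what the answer IS (N, Mᵢ, vᵢ), why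
the far field obeys it, and why each hole settles. The card
separates them at 𝓘⁺: by the Bondi mass-loss law (ChristodoulouKlainerman1993 Ch. 17; Bondi–van der
Burg–Metzner 1962) the late-time mass aspect
m_∞ is a soft, frame-robust object, and "N receding Kerrs" has the 𝓘⁺-shadow "m_∞ is a finite
positive combination of boosted-monopole
kernels" — the standing ansatz of the flux-balance / memory literature (arXiv:1912.03164,
arXiv:1411.5745 App. B, doi:10.1088/0264-9381/4/5/010)
promoted to a falsifiable conjecture, with a MOMENT-PROBLEM uniqueness lemma (partial fractions on
S²: poles = 4-velocities, residues =
masses) imported from classical analysis. The typed spine is the consequence form the prelude can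
express today (KerrConvergence charts):
X1 = 𝓘⁺ side (WCC + finite memory + atomicity + inward reconstruction of the radiation zone, in the
spirit of the scattering construction
arXiv:1306.5364 and of stationarity-from-infinity arXiv:1504.04592), X2 = near-zone capture
(large-data Kerr capture inside sublinear tubes:
DafermosLuk2017 Conj. 1, KlainermanSzeftel2023, arXiv210408222, rigidity
AlexakisIonescuKlainerman2009). Genericity in Christodoulou's curve
sense is monotone but not closed under ∧ (card genericity-is-not-closed-under-and), so ALL generic
content (incl. "no extremal remnant",
KehleUnger2025 / arXiv:2402.10190 being threshold phenomena) sits in X1 and X2 is pointwise; the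
glue is then pure logic
(ChristodoulouGenericMono). No FSC route exists yet (ledger route ls: 0 for this summit), so nothing
is restated; negatives index empty.

RANKED CRUXES. #2 GenericRadiationZone (crux) — [card items (3)+(4)+(5), consequence form] For every
connected Hausdorff second-countable smooth 3-manifold X, the property "D has an MGHD, and every
MGHD 𝒟 of D (i) has complete future null infinity, (ii) admits a radiation-zone structure: N,
motions (Λᵢ, cᵢ) ∈ O(1,3) × ℝ⁴, τ₀, excision radii ρᵢ with ρᵢ(t)/t → 0, an open U ⊇ {x⁰ > τ₀, ρᵢ(x⁰)
< |spatial part of Λᵢ⁻¹(x − cᵢ)| ∀ i} and a late chart Ψ : U → J⁺(ιX) (smooth, open embedding of {x⁰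
> τ₀}) with C² deviation of Ψ^*g from η on the slabs {x⁰ = τ} ∩ U tending to 0, and (iii) admits no
late chart from a boosted Kerr exterior with 0 < M ≤ |a| into J⁺(ιX) whose C⁰ deviation on every
truncated slab {t* = τ, r ≤ R} tends to 0" is Christodoulou-generic (codimension ≥ 1) in
admissibleVacuumData X. Intended proof = the 𝓘⁺ mechanism: complete 𝓘⁺ + finite memory +
SupermomentumAtomicity (generic) and ScriToBulkRadiationZone (pointwise), glued by
ChristodoulouGenericMono. [difficulty: open-problem] (why it might fail: Contains weak cosmic
censorship and N<∞ generically; its 𝓘⁺ proof needs finite memory and an ATOMIC m_∞ — a diffuse m_∞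
(infinite cascade of ever smaller late holes, energy reaching neither 𝓘⁺ nor a horizon) or no inward
smallness beyond news→0 breaks it.) [Christodoulou1999, ChristodoulouKlainerman1993,
arXiv:1912.03164, arXiv:1411.5745, doi:10.1088/0264-9381/4/5/010, arXiv:1306.5364,
Kehrberger2022AHP, KehleUnger2025]
#3 NearZoneCapture (crux) — [card items (4) near part + per-hole stability, POINTWISE] For every X
as above, every D ∈ admissibleVacuumData X and every maximal vacuum Cauchy development 𝒟 of D: if 𝒟
has complete future null infinity, admits a radiation-zone structure (as in GenericRadiationZone
(ii)) and admits no degenerate-Kerr late chart (as in (iii)), then there are O and a C² N-hole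
FinalStateDecomposition d of 𝒟 on O with every hole sub-extremal (|aᵢ| < Mᵢ), O = exteriorOf 𝒟
d.charted and HasExhaustiveCharts d — i.e. exactly the inner conclusion of the Statement. Content:
inside each sublinear tube the vacuum geometry is captured by ONE boosted Kerr near zone (large-data
asymptotic stability with decaying incoming flux from the radiation zone), the limit is Kerr by
rigidity, sub-extremal by (iii), and the charts are normalised to the event horizons so that they
exhaust J⁺(ιX) ∩ I⁻(charted). [difficulty: open-problem] (why it might fail: Pointwise, no
genericity left: ONE admissible datum with complete 𝓘⁺ and a radiation zone whose tube hides an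
eternal or parabolic binary, an infinite cascade, a non-settling or non-Kerr end refutes it; needs
large-data Kerr capture and rigidity without analyticity (AIK is local).) [DafermosLuk2017,
KlainermanSzeftel2023, GiorgiKlainermanSzeftel2022, arXiv210408222, AlexakisIonescuKlainerman2009,
arXiv:1504.04592, KehleUnger2025, arXiv:2402.10190, Aretakis2015]
#9 ChristodoulouGenericMono (support) — [glue lemma, provable now] Christodoulou genericity is
monotone in the property: if P → Q on the admissible class 𝓓 then IsChristodoulouGeneric 𝓓 P m →
IsChristodoulouGeneric 𝓓 Q m (the exceptional set of Q lies in that of P and the same one-parameter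
families serve). Two lines over Genericity.lean; it is the glue of every "generic(A) + pointwise(A →
B)" assembly on this summit. [difficulty: provable-now] [Christodoulou1999, Christodoulou2008]
#9 KernelMomentum (support) — [card lemma (ii) check, provable now, Mathlib only] The
boosted-monopole kernel K_v(n) = (1 − |v|²)^{3/2} (1 − v·n)⁻³ on the unit sphere S² ⊂ ℝ³ (|v| < 1)
has sphere averages ⨍ K_v = γ_v = (1 − |v|²)^{-1/2} and ⨍ K_v ⟨n, w⟩ = γ_v ⟨v, w⟩: its 4-momentum is
that of a hole of unit mass boosted to velocity v (Bondi 4-momentum (4π)⁻¹∮ m (1, n) dΩ).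
Computation: 2π∫₋₁¹(1 − s x)⁻³ dx = 4π/(1 − s²)², 2π∫₋₁¹ x(1 − s x)⁻³ dx = 4πs/(1 − s²)².
[difficulty: provable-now] [ChristodoulouKlainerman1993, arXiv:1411.5745, Wald1984]
#9 KernelIndependence (support) — [card lemma (iii), provable now, Mathlib only] The kernels {K_v :
|v| < 1} are linearly independent as real functions on S²; hence a finite positive combination Σ Mᵢ
K_{vᵢ} with pairwise distinct vᵢ determines (N, Mᵢ, vᵢ) uniquely — "count the black holes by partial
fractions". Proof sketch: restrict to a great circle chosen so that the projections of the finitely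
many vᵢ are pairwise distinct; in z = e^{iθ} each K_{vᵢ} is a rational function with a triple pole
pair determined by (|proj vᵢ|, arg), distinct poles ⇒ independence (the v = 0 kernel is the
constant). [difficulty: provable-now] [arXiv:1411.5745, doi:10.1088/0264-9381/4/5/010]

TWO-LAYER PLAN. Foreseen glued splits (k ≤ 3, depth 1), filed only after a crux closes or the
definition lands:
GenericRadiationZone ⇐ ScriAtomicityGeneric → ScriToBulkRadiationZone → GenericRadiationZone, where
ScriAtomicityGeneric = generic(MGHD ∧ ∀ MGHD:
complete 𝓘⁺ ∧ Bondi–Sachs radiative end with ∫∫|N|² < ∞ ∧ finite memory ∧ m_∞ atomic ∧ no degenerate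
Kerr limit) and ScriToBulkRadiationZone =
pointwise(complete 𝓘⁺ ∧ radiative end ∧ news → 0 ∧ m_∞ = Σ Mᵢ K_{vᵢ} ⟹ radiation-zone structure with
N tubes along the boosts of the vᵢ);
glue = ChristodoulouGenericMono again (these two are filed now as informal top-level cruxes, ranks
4–5, typed once BondiSachsRadiativeEnd lands).
NearZoneCapture ⇐ TubeCapture (each tube: a near-zone chart converging on truncated slabs to one
boosted Kerr, holes separating) → ExhaustiveAssembly
(build O = J⁺(ιX) ∩ I⁻(charted), horizon-normalised charts, HasExhaustiveCharts, sub-extremality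
from the no-degenerate-limit clause) → NearZoneCapture.

KILL CRITERIA. An admissible datum whose MGHD has complete 𝓘⁺ and a radiation-zone structure but
provably no sub-extremal exhaustive decomposition (an eternal
vacuum binary inside a sublinear tube, a vacuum "parking" solution, or extremal-Kerr formation
WITHOUT any C⁰-settling chart) refutes NearZoneCapture:
close `refuted:NearZoneCapture` unless the witness is visibly non-generic, in which case pivot by
moving the violated clause into GenericRadiationZone
(restate, same decl). A diffuse or frame-dependent m_∞ for an open set of data (numerical
BMS-frame-fixed catalogues would show it first) kills the
𝓘⁺ mechanism and with it the reason for this route (close `refuted:SupermomentumAtomicity` once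
typed); GenericRadiationZone itself would survive
only as a restatement and the route should then be closed superseded by whichever route owns the
radiation zone. WCC failing generically refutes
GenericRadiationZone and the summit alike.

NOT DECOMPOSED YET. The 𝓘⁺ layer is deliberately informal at open: Lean has no Bondi–Sachs radiative
end over CauchyDevelopment (BondiMass.lean's BondiFoliation
sits over the uninhabited `Development`; ConformalCompletion is a bare structure), so
SupermomentumAtomicity / ScriToBulkRadiationZone /
LateMassAspectSoft are filed as informal items plus the definition request, and typed by a grounder
when it lands. Not split either: WCC vs
atomicity inside GenericRadiationZone (genericity is not closed under ∧, so they stay in one basket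
until a pointwise bridge is found);
per-hole stability vs exhaustion/horizon normalisation inside NearZoneCapture; BMS boost covariance
of the atomic class (K_v ∘ boost =
conformal-weight-3 transform, atoms ↦ atoms) and the angular-momentum aspect readout of spins —
layer-2 support at most.

CHEAPEST FALSIFIER. Fit m_∞ of a BMS-frame-fixed numerical two-body remnant or fly-by (SXS/CCE
catalogues with superrest-frame fixing, Mitman et al.
doi:10.1103/physrevd.106.084029) by Σ Mᵢ K_{vᵢ}: a residual ℓ ≥ 2 supermomentum in EVERY frame for
an N = 1 remnant, or a non-atomic
two-centre profile for a hyperbolic encounter, retires the mechanism at once. Second cheapest: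
KernelIndependence is a Lean exercise — if the
kernels were dependent the readout (and the card's elegance claim) dies; the great-circle pole
argument says they are not. Not run here
(no kit in plancard mode); the N = 1 case is the routine superrest-frame practice of numerical
relativity and passes.

NUMBERS. K_v(n) = γ_v⁻³ (1 − v·n)⁻³, ⨍_{S²} K_v = γ_v, ⨍_{S²} K_v n = γ_v v (KernelMomentum); N = 0
⟺ m_∞ = 0 ⟺ final Bondi mass 0. Bondi mass loss
∂_u M_B = −(32π)⁻¹∮|Ξ|² (ChristodoulouKlainerman1993 17.0.8, prelude normalisation). Expected late
news decay |N| ≲ u⁻² (hyperbolic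
separation, d³Q/dt³ ∼ t⁻²) and u^{-5/3} (parabolic), both giving ∫∮|N| < ∞ (finite memory) and
∫∮|N|² < ∞. Known capture theorems: |a| ≪ M
(KlainermanSzeftel2023, GiorgiKlainermanSzeftel2022), a = 0 codimension-3 (arXiv210408222); extremal
formation: threshold phenomenon
(KehleUnger2025 Einstein–Maxwell–charged scalar; vacuum Kerr conjectured, arXiv:2402.10190). Items
at open: 6 typed (2 cruxes, 3 support,
1 assembly) + 3 informal filed after open.

DEFINITION REQUESTS. D1 `BondiSachsRadiativeEnd` (topic Literature/Geometry/Lorentzian; for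
SupermomentumAtomicity): hypothesis structure over a `CauchyDevelopment D`
of 3-dimensional data with complete 𝓘⁺ — a retarded-time family of outgoing null hypersurfaces C_u
(u ≥ u₀) with sections receding to
infinity, and the CK Ch. 17 limits as fields: Bondi mass aspect m : ℝ → C(S²) (limit of the
Hawking-mass density), asymptotic shear σ and
news N = ∂_u σ̄ with ∫∫|N|² < ∞, the mass-loss law ∂_u m = −|N|² + (linear divergence term) weakly
on S², Bondi mass M_B(u) = ⨍ m(u,·);
plus predicates `HasLateMassAspect 𝓔 m∞` (m(u,·) → m∞ in 𝒟'(S²), equivalently in L¹ after smearing)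
and `HasFiniteMemory 𝓔`
(σ(u,·) → σ_∞ in L¹(S²)); behaviour under supertranslations/boosts recorded as lemmas, not axioms.
Sources: Bondi–van der Burg–Metzner
1962, Sachs 1962, ChristodoulouKlainerman1993 Ch. 17, Mädler–Winicour arXiv:1609.01731,
arXiv:2102.03221.
D2 `boostedMonopoleKernel` / `IsAtomicMassAspect` (topic
Summits/FinalStateConjecture/FinalStateConjecture/Theorems; new objects of this
route): K_v(n) := (1 − ‖v‖²)^{3/2} (1 − ⟪v, n⟫)⁻³ on Metric.sphere 0 1 ⊂ ℝ³ for ‖v‖ < 1, and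
IsAtomicMassAspect m∞ N M v :⟺ m∞ = Σ_{i<N} Mᵢ K_{vᵢ}
with Mᵢ > 0, vᵢ pairwise distinct (inlined today in KernelMomentum / KernelIndependence).

Novelty: Searches (2026-08-15): `lit search --hybrid "late time Bondi mass aspect supermomentum final state
multiple black holes null infinity"` (12 book
hits, none on point: CK1993, Wald1984); `lit search --source zbmath "Bondi mass" --year-from 2015`
(20: Chen–Wang–Wang–Yau quasi-local /
supertranslation-invariance series arXiv:2102.03221, arXiv:2204.03182; Blanchet–Compère–Faye et al.
Bondi aspects arXiv:2303.07732; He–Lindblad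
arXiv:2107.01487); `lit search --source zbmath "scattering theory construction dynamical vacuum
black holes"` (arXiv:1306.5364);
`… "extremal black hole formation third law"` (arXiv:2211.15742 = KehleUnger2025); crossref "Kehle
Unger event horizon gluing vacuum"
(doi:10.1016/j.aim.2024.109816); `lit galaxy search "supermomentum" --star all` (30 rows: Mitman
2024 Caltech thesis on BMS frames/memory,
Khera–Ashtekar–Krishnan, Magdy–Prabhu–Valiente Kroon; nothing on a multi-atom late-time conjecture);
galaxy pdf "boosted Schwarzschild mass
aspect", "final BMS frame" (0); plus the card's own crossref/zbMATH/galaxy log and its 2nd-pass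
audit (arXiv:1912.03164, arXiv:1411.5745 App. B,
doi:10.1088/0264-9381/4/5/010, doi:10.1088/0264-9381/17/18/305, doi:10.1007/s10714-020-02764-1,
doi:10.1103/physrevd.106.084029).
OpenAlex/S2/arXiv APIs were rate-limited this hour (429); zbMATH/crossref/galaxy/local used instead.
Nearest prior art found: arXiv:1912.03164 (Compère–Oliveri–Seraj: Poincaré/BMS flux-balance for
binaries, final BMS frame from asymptotic momenta)
and arXiv  [refs: 10.1016/j.aim.2024.109816, 10.1088/0264-9381/4/5/010, 10.1088/0264-9381/17/18/305, 10.1007/s10714-020-02764-1, 10.1103/physrevd.106.084029, 2102.03221, 2204.03182, 2303.07732, 2107.01487, 1306.5364, 2211.15742, 1912.03164, 1411.5745, doi:10.1016/j.aim.2024.109816, doi:10.1088/0264-9381/4/5/010, doi:10.1088/0264-9381/17/18/305, doi:10.1007/s10714-020-02764-1, doi:10.1103/physrevd.106.084029, Wald19]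

Barriers (technique_class: null-infinity-charges, moment-problem, scattering-from-scri): - technique_class: null-infinity-charges, moment-problem, scattering-from-scri
- Literature.Barriers.FinalStateConjecture.KehrbergerLogarithmicAsymptotics: evaded — only the
leading radiative structure (mass aspect, shear, news at CK regularity) and C²/C⁰ chart convergence
are used; no peeling, no conformal smoothness, no integer-power expansion; the log terms live at
orders (r⁻⁴ log r in β) the line never touches.
- Literature.Barriers.FinalStateConjecture.KehrbergerLogarithmicAsymptoticsCorrected: same evasion
(sign-insensitive); the typed items are stated over the intrinsic NullInfinity/KerrConvergence
notions, not over a conformal completion.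
- Literature.Barriers.FinalStateConjecture.PriceLawTail: harmless — existence of m_∞ needs ∫∮|N|² <
∞ and ∫∮|N| < ∞, both compatible with u⁻² news and t⁻³ tails; no rate for m → m_∞ or for the chart
deviations is asserted (Tendsto only).
- Literature.Barriers.FinalStateConjecture.AretakisInstability: met head-on and used — extremal
remnants do not C²-settle along the horizon, so sub-extremality cannot be read off a C² limit; the
no-degenerate-Kerr-limit clause is therefore stated in C⁰ on truncated slabs and placed on the
GENERIC side (extremal formation is a threshold phenomenon, KehleUnger2025), and NearZoneCapture
receives it as a hypothesis.
- Literature.Barriers.FinalStateConjecture.HairyKerrBifurcation: not met — vacuum only; "atomic ⇒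
Kerr interiors" is claimed via vacuum capture + vacuum rigidity inside NearZoneCapture, never

sub-problem: FinalStateConjecture · status: open · opened planner-plancard-FinalStateConjecture-FinalSt-0d9e34ad-0 2026-08-15T14:57:02Z · rev 0 · ledger route-FinalStateConjecture-AtomicSupermomentum
GENERATED by the gate from the ledger (D-0016/17). Provers cite these decls: `theorem foo : Summit.FinalStateConjecture.FinalStateConjecture.Theses.AtomicSupermomentum.<Decl> := …` in Summits/FinalStateConjecture/FinalStateConjecture/Theorems/<Name>.lean.
-/

namespace Summit.FinalStateConjecture.FinalStateConjecture.Theses.AtomicSupermomentum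

open scoped BigOperators Topology Manifold Classical MeasureTheory ProbabilityTheory Matrix InnerProductSpace ComplexConjugate ContinuousMap
open Filter Set Function TopologicalSpace MeasureTheory

attribute [summit_statement] _root_.FinalStateConjecture

/-- item stmt-FinalStateConjecture-9943 · crux · rank 2 · open · by planner
why it might fail: Contains weak cosmic censorship and N<∞ generically; its 𝓘⁺ proof needs finite memory and an ATOMIC m_∞ — a diffuse m_∞ (infinite cascade of ever smaller late holes, energy reaching neither 𝓘⁺ nor a horizon) or no inward smallness beyond news→0 breaks it.
sources: Christodoulou1999, ChristodoulouKlainerman1993, arXiv:1912.03164, arXiv:1411.5745, doi:10.1088/0264-9381/4/5/010, arXiv:1306.5364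
[crux] [card items (3)+(4)+(5), consequence form] For every connected Hausdorff second-countable
smooth 3-manifold X, the property "D has an MGHD, and every MGHD 𝒟 of D (i) has complete future null
infinity, (ii) admits a radiation-zone structure: N, motions (Λᵢ, cᵢ) ∈ O(1,3) × ℝ⁴, τ₀, excision
radii ρᵢ with ρᵢ(t)/t → 0, an open U ⊇ {x⁰ > τ₀, ρᵢ(x⁰) < |spatial part of Λᵢ⁻¹(x − cᵢ)| ∀ i} and a
late chart Ψ : U → J⁺(ιX) (smooth, open embedding of {x⁰ > τ₀}) with C² deviation of Ψ^*g from η on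
the slabs {x⁰ = τ} ∩ U tending to 0, and (iii) admits no late chart from a boosted Kerr exterior
with 0 < M ≤ |a| into J⁺(ιX) whose C⁰ deviation on every truncated slab {t* = τ, r ≤ R} tends to 0"
is Christodoulou-generic (codimension ≥ 1) in admissibleVacuumData X. Intended proof = the 𝓘⁺
mechanism: complete 𝓘⁺ + finite memory + SupermomentumAtomicity (generic) and
ScriToBulkRadiationZone (pointwise), glued by ChristodoulouGenericMono. [difficulty: open-problem] -/
@[route_item "route-FinalStateConjecture-AtomicSupermomentum", crux]
def GenericRadiationZone : Prop :=
  open Literature.Geometry.Lorentzian in ∀ (X : Type) [TopologicalSpace X] [ChartedSpace E3 X] [IsManifold (𝓡 3) ((⊤ : ℕ∞) : WithTop ℕ∞) X] [T2Space X] [SecondCountableTopology X] [ConnectedSpace X], InitialDataSet.IsChristodoulouGeneric (admissibleVacuumData X) (fun D ↦ (∃ 𝒟 : VacuumCauchyDevelopment D, 𝒟.IsMaximal) ∧ ∀ 𝒟 : VacuumCauchyDevelopment D, 𝒟.IsMaximal → HasCompleteNullInfinity 𝒟.toCauchyDevelopment ∧ (∃ (N : ℕ) (Λ : Fin N → lorentzGroup)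 (c : Fin N → E4) (τ₀ : ℝ) (ρ : Fin N → ℝ → ℝ) (U : Opens E4) (Ψ : U → 𝒟.carrier), (∀ i, Tendsto (fun t ↦ ρ i t / t) atTop (𝓝 0)) ∧ {x : E4 | τ₀ < x 0 ∧ ∀ i, ρ i (x 0) < E4.spatialNorm (poincareInv (Λ i) (c i) x)} ⊆ (U : Set E4) ∧ 𝒟.toSpacetime.IsLateChart (Minkowski.backgroundOn U) (𝒟.metric.causalFuture 𝒟.timeOrientation (range 𝒟.embed)) τ₀ Ψ ∧ Tendsto (fun τ ↦ 𝒟.toSpacetime.deviationCk (Minkowski.backgroundOn U) Ψ 2 τ) atTop (𝓝 0)) ∧ ¬ ∃ (M a : ℝ) (Λ : lorentzGroup) (c : E4) (τ₀ : ℝ) (Ψ : boostedKerrExterior Λ c M a → 𝒟.carrier), 0 < M ∧ M ≤ |a| ∧ 𝒟.toSpacetime.IsLateChart (boostedKerrBackground Λ c M a) (𝒟.metric.causalFuture 𝒟.timeOrientation (range 𝒟.embed)) τ₀ Ψ ∧ ∀ R : ℝ, Tendsto (fun τ ↦ 𝒟.toSpacetime.truncDeviationCk (boostedKerrBackground Λ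 c M a) Ψ 0 R τ) atTop (𝓝 0)) 1

/-- item stmt-FinalStateConjecture-9944 · crux · rank 3 · open · by planner
why it might fail: Pointwise, no genericity left: ONE admissible datum with complete 𝓘⁺ and a radiation zone whose tube hides an eternal or parabolic binary, an infinite cascade, a non-settling or non-Kerr end refutes it; needs large-data Kerr capture and rigidity without analyticity (AIK is local).
sources: DafermosLuk2017, KlainermanSzeftel2023, GiorgiKlainermanSzeftel2022, arXiv210408222, AlexakisIonescuKlainerman2009, arXiv:1504.04592
[crux] [card items (4) near part + per-hole stability, POINTWISE] For every X as above, every D ∈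
admissibleVacuumData X and every maximal vacuum Cauchy development 𝒟 of D: if 𝒟 has complete future
null infinity, admits a radiation-zone structure (as in GenericRadiationZone (ii)) and admits no
degenerate-Kerr late chart (as in (iii)), then there are O and a C² N-hole FinalStateDecomposition d
of 𝒟 on O with every hole sub-extremal (|aᵢ| < Mᵢ), O = exteriorOf 𝒟 d.charted and
HasExhaustiveCharts d — i.e. exactly the inner conclusion of the Statement. Content: inside each
sublinear tube the vacuum geometry is captured by ONE boosted Kerr near zone (large-data asymptotic
stability with decaying incoming flux from the radiation zone), the limit is Kerr by rigidity,
sub-extremal by (iii), and the charts are normalised to the event horizons so that they exhaust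
J⁺(ιX) ∩ I⁻(charted). [difficulty: open-problem] -/
@[route_item "route-FinalStateConjecture-AtomicSupermomentum", crux]
def NearZoneCapture : Prop :=
  open Literature.Geometry.Lorentzian in ∀ (X : Type) [TopologicalSpace X] [ChartedSpace E3 X] [IsManifold (𝓡 3) ((⊤ : ℕ∞) : WithTop ℕ∞) X] [T2Space X] [SecondCountableTopology X] [ConnectedSpace X], ∀ D ∈ admissibleVacuumData X, ∀ 𝒟 : VacuumCauchyDevelopment D, 𝒟.IsMaximal → HasCompleteNullInfinity 𝒟.toCauchyDevelopment → (∃ (N : ℕ) (Λ : Fin N → lorentzGroup) (c : Fin N → E4) (τ₀ : ℝ) (ρ : Fin N → ℝ → ℝ) (U : Opens E4) (Ψ : U → 𝒟.carrier), (∀ i, Tendsto (fun t ↦ ρ i t / t) atTop (𝓝 0)) ∧ {x : E4 | τ₀ < x 0 ∧ ∀ i, ρ i (x 0) < E4.spatialNorm (poincareInv (Λ i) (c i) x)} ⊆ (U : Set E4) ∧ 𝒟.toSpacetime.IsLateChart (Minkowski.backgroundOn U) (𝒟.metric.causalFuture 𝒟.timeOrientation (range 𝒟.embed)) τ₀ Ψ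 ∧ Tendsto (fun τ ↦ 𝒟.toSpacetime.deviationCk (Minkowski.backgroundOn U) Ψ 2 τ) atTop (𝓝 0)) → (¬ ∃ (M a : ℝ) (Λ : lorentzGroup) (c : E4) (τ₀ : ℝ) (Ψ : boostedKerrExterior Λ c M a → 𝒟.carrier), 0 < M ∧ M ≤ |a| ∧ 𝒟.toSpacetime.IsLateChart (boostedKerrBackground Λ c M a) (𝒟.metric.causalFuture 𝒟.timeOrientation (range 𝒟.embed)) τ₀ Ψ ∧ ∀ R : ℝ, Tendsto (fun τ ↦ 𝒟.toSpacetime.truncDeviationCk (boostedKerrBackground Λ c M a) Ψ 0 R τ) atTop (𝓝 0)) → ∃ (O : Set 𝒟.carrier) (d : FinalStateDecomposition 𝒟.toSpacetime O 2), (∀ i, Kerr.IsSubextremal (d.mass i) (d.spin i)) ∧ O = exteriorOf 𝒟.toCauchyDevelopment d.charted ∧ HasExhaustiveCharts d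

/-- item stmt-FinalStateConjecture-9945 · support · rank 9 · open · by planner
sources: Christodoulou1999, Christodoulou2008
[support] [glue lemma, provable now] Christodoulou genericity is monotone in the property: if P → Q
on the admissible class 𝓓 then IsChristodoulouGeneric 𝓓 P m → IsChristodoulouGeneric 𝓓 Q m (the
exceptional set of Q lies in that of P and the same one-parameter families serve). Two lines over
Genericity.lean; it is the glue of every "generic(A) + pointwise(A → B)" assembly on this summit.
[difficulty: provable-now] -/
@[route_item "route-FinalStateConjecture-AtomicSupermomentum", crux]
def ChristodoulouGenericMono : Prop :=
  open Literature.Geometry.Lorentzian in ∀ (X : Type) [TopologicalSpace X] [ChartedSpace E3 X] [IsManifold (𝓡 3) ((⊤ : ℕ∞) : WithTop ℕ∞) X] (𝓓 : Set (InitialDataSet (𝓡 3) X)) (P Q : InitialDataSet (𝓡 3) X → Prop) (m : ℕ), (∀ D ∈ 𝓓, P D → Q D) → InitialDataSet.IsChristodoulouGeneric 𝓓 P m → InitialDataSet.IsChristodoulouGeneric 𝓓 Q m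

/-- item stmt-FinalStateConjecture-9946 · support · rank 9 · open · by planner
sources: ChristodoulouKlainerman1993, arXiv:1411.5745, Wald1984
[support] [card lemma (ii) check, provable now, Mathlib only] The boosted-monopole kernel K_v(n) =
(1 − |v|²)^{3/2} (1 − v·n)⁻³ on the unit sphere S² ⊂ ℝ³ (|v| < 1) has sphere averages ⨍ K_v = γ_v =
(1 − |v|²)^{-1/2} and ⨍ K_v ⟨n, w⟩ = γ_v ⟨v, w⟩: its 4-momentum is that of a hole of unit mass
boosted to velocity v (Bondi 4-momentum (4π)⁻¹∮ m (1, n) dΩ). Computation: 2π∫₋₁¹(1 − s x)⁻³ dx =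
4π/(1 − s²)², 2π∫₋₁¹ x(1 − s x)⁻³ dx = 4πs/(1 − s²)². [difficulty: provable-now] -/
@[route_item "route-FinalStateConjecture-AtomicSupermomentum"]
def KernelMomentum : Prop :=
  ∀ v : EuclideanSpace ℝ (Fin 3), ‖v‖ < 1 → (⨍ n, Real.sqrt (1 - ‖v‖ ^ 2) ^ 3 * ((1 - ⟪v, (n : EuclideanSpace ℝ (Fin 3))⟫_ℝ)⁻¹) ^ 3 ∂(volume : Measure (EuclideanSpace ℝ (Fin 3))).toSphere) = (Real.sqrt (1 - ‖v‖ ^ 2))⁻¹ ∧ ∀ w : EuclideanSpace ℝ (Fin 3), (⨍ n, Real.sqrt (1 - ‖v‖ ^ 2) ^ 3 * ((1 - ⟪v, (n : EuclideanSpace ℝ (Fin 3))⟫_ℝ)⁻¹) ^ 3 * ⟪(n : EuclideanSpace ℝ (Fin 3)), w⟫_ℝ ∂(volume : Measure (EuclideanSpace ℝ (Fin 3))).toSphere) = (Real.sqrt (1 - ‖v‖ ^ 2))⁻¹ * ⟪v, w⟫_ℝ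

/-- item stmt-FinalStateConjecture-9947 · support · rank 9 · open · by planner
sources: arXiv:1411.5745, doi:10.1088/0264-9381/4/5/010
[support] [card lemma (iii), provable now, Mathlib only] The kernels {K_v : |v| < 1} are linearly
independent as real functions on S²; hence a finite positive combination Σ Mᵢ K_{vᵢ} with pairwise
distinct vᵢ determines (N, Mᵢ, vᵢ) uniquely — "count the black holes by partial fractions". Proof
sketch: restrict to a great circle chosen so that the projections of the finitely many vᵢ are
pairwise distinct; in z = e^{iθ} each K_{vᵢ} is a rational function with a triple pole pair
determined by (|proj vᵢ|, arg), distinct poles ⇒ independence (the v = 0 kernel is the constant).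
[difficulty: provable-now] -/
@[route_item "route-FinalStateConjecture-AtomicSupermomentum"]
def KernelIndependence : Prop :=
  LinearIndependent ℝ (fun v : Metric.ball (0 : EuclideanSpace ℝ (Fin 3)) 1 ↦ fun n : Metric.sphere (0 : EuclideanSpace ℝ (Fin 3)) 1 ↦ Real.sqrt (1 - ‖(v : EuclideanSpace ℝ (Fin 3))‖ ^ 2) ^ 3 * ((1 - ⟪(v : EuclideanSpace ℝ (Fin 3)), (n : EuclideanSpace ℝ (Fin 3))⟫_ℝ)⁻¹) ^ 3)

/-- item stmt-FinalStateConjecture-9948 · assembly · rank 1 · open · by planner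
sources: DafermosLuk2017, Christodoulou1999
[assembly] GenericRadiationZone → NearZoneCapture → ChristodoulouGenericMono → FinalStateConjecture. -/
@[route_item "route-FinalStateConjecture-AtomicSupermomentum"]
def Assembly : Prop :=
  GenericRadiationZone → NearZoneCapture → ChristodoulouGenericMono → FinalStateConjecture

/-! D-0027 §2.1 — DECIDING THEOREM (planner-authored via `route open/edit --closes-file`; by planner-plancard-FinalStateConjecture-FinalSt-0d9e34ad-0 2026-08-15T14:57:02Z):
its hypotheses are this route's items and its conclusion the sub-problem Statement (glue_lint), and it elaborates with this file. -/

@[closes "route-FinalStateConjecture-AtomicSupermomentum"] theorem closes (h₁ : GenericRadiationZone) (h₂ : NearZoneCapture) (h₃ : ChristodoulouGenericMono) :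
    FinalStateConjecture := by
  dsimp only [GenericRadiationZone, NearZoneCapture, ChristodoulouGenericMono] at h₁ h₂ h₃
  intro X _ _ _ _ _ _
  refine h₃ X _ _ _ 1 ?_ (h₁ X)
  rintro D hD ⟨hex, hall⟩
  exact ⟨hex, fun 𝒟 hmax ↦ ⟨(hall 𝒟 hmax).1,
    h₂ X D hD 𝒟 hmax (hall 𝒟 hmax).1 (hall 𝒟 hmax).2.1 (hall 𝒟 hmax).2.2⟩⟩

end Summit.FinalStateConjecture.FinalStateConjecture.Theses.AtomicSupermomentum
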